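import Summits.PneNP.PneNP.Theorems.PeaTwoMemBPP.Negative.CensusDoesNotDetermineEntropy

/-!
# PneNP / SzkEntropy — crux `PeaTwoMemBPP` (stmt-PneNP-10778), negative side: the bias census is multiplicative, so census-equivalent quadratic maps have unbounded entropy gaps

Route `PneNP/SzkEntropy`, crux stmt-PneNP-10778 (`PEA 2 ∈ PromiseBPP'`).  Complement to
`CensusDoesNotDetermineEntropy.lean` (whose `census_does_not_determine_entropy` exhibits ONE
census-equivalent pair of quadratic maps with Shannon gap `> 1` by finite evaluation): here the
amplification step is proved in general, with no evaluation.

* `intBias_prod`, `census_prod` — **the signed bias census of a direct product is the product of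
  the censuses** (a character of `F₂^{m+m'}` is a pair of characters, and the bias of an appended
  character on `P × Q` factorises: `Σ_{(x,x')} (−1)^{c·P x + c'·Q x'} = (Σ_x (−1)^{c·P x})(Σ_{x'}
  (−1)^{c'·Q x'})`); hence `census_prod_congr`: census-equivalence is preserved by direct products.
* `pow P t` (the `t`-fold direct power, degree-preserving `pow_degLE`, entropy `t · H(P)`,
  `entropy_pow`) and `census_gap_amplify`: a census-equivalent pair with gap `> δ` yields, for every
  `t`, a census-equivalent pair with gap `≥ t·δ`.
* `census_equivalent_gap_unbounded` — **for every `T` there are census-equivalent QUADRATIC maps whose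
  Shannon entropies differ by more than `T` bits** (powers of the `n = 4` pair `witA`/`witB`, gap
  `17/48` per factor).  So no census-reading procedure approximates the entropy of quadratic maps to
  ANY additive constant — the census/rank-type statistics of the pencil carry the Rényi-2 entropy and
  nothing more of the Shannon entropy.

References: Z. Dvir, D. Gutfreund, G. N. Rothblum, S. Vadhan, *On approximating the entropy of
polynomial mappings*, ICS 2011 (ECCC TR10-160), §3 p. 6 (direct products), Claim 5.6;
R. Lidl, H. Niederreiter, *Finite Fields*, Ch. 5 (characters of `F₂ⁿ`, orthogonality).
-/

namespace Summit.PneNP.PneNP.Theorems.PeaTwoMemBPP.Negative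

open Literature.Computability.Complexity Literature.InformationTheory.Entropy
open PolyMapF2

variable {n n' : ℕ}

/-! ### Multiplicativity of the census -/

/-- Length-explicit census (the census of `P` is `census' P.length (outputs P)`, so that
`(P.prod Q).length = P.length + Q.length` can be rewritten). [folklore] -/
def census' (m : ℕ) (O : Multiset (List (ZMod 2))) : Multiset ℤ :=
  (Finset.univ : Finset (Fin m → ZMod 2)).val.map fun c => intBias O (List.ofFn c)

/-- `census P = census' P.length (outputs P)`. [folklore] -/
theorem census_eq_census' (P : PolyMapF2 n) : census P = census' P.length (outputs P) := rfl

/-- The product of two censuses: the multiset of pairwise products of biases. [folklore] -/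
def mulCensus (C D : Multiset ℤ) : Multiset ℤ := (C ×ˢ D).map fun p => p.1 * p.2

/-- The sign character `(−1)^t` of `ZMod 2`, as an integer. [folklore] -/
def sgn (t : ZMod 2) : ℤ := if t = 0 then 1 else -1

/-- `(−1)^{a+b} = (−1)^a (−1)^b`. [folklore] -/
theorem sgn_add (a b : ZMod 2) : sgn (a + b) = sgn a * sgn b := by
  fin_cases a <;> fin_cases b <;> rfl

/-- Dot products of appended lists add (when the first lengths match). [folklore] -/
theorem dotL_append {cl₁ cl₂ l₁ l₂ : List (ZMod 2)} (h : cl₁.length = l₁.length) :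
    dotL (cl₁ ++ cl₂) (l₁ ++ l₂) = dotL cl₁ l₁ + dotL cl₂ l₂ := by
  unfold dotL
  rw [List.zipWith_append h, List.sum_append]

/-- The integer bias as a character sum over the points: `Σ_x (−1)^{c · P(x)}`.
[LidlNiederreiter1997, Ch. 5 (additive characters)] -/
theorem intBias_outputs (P : PolyMapF2 n) (cl : List (ZMod 2)) :
    intBias (outputs P) cl = ∑ x : Fin n → ZMod 2, sgn (dotL cl (P.eval x)) := by
  unfold intBias outputs sgn
  rw [Multiset.map_map]
  rfl

/-- **Bias of an appended character on a direct product = product of the biases** (the character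
sum over `F₂^{n+n'}` factorises). [DvirGutfreundRothblumVadhan2010, §3 p. 6; LidlNiederreiter1997, Ch. 5] -/
theorem intBias_prod (P : PolyMapF2 n) (Q : PolyMapF2 n') {cl₁ cl₂ : List (ZMod 2)}
    (h : cl₁.length = P.length) :
    intBias (outputs (P.prod Q)) (cl₁ ++ cl₂) =
      intBias (outputs P) cl₁ * intBias (outputs Q) cl₂ := by
  rw [intBias_outputs, intBias_outputs, intBias_outputs, Finset.sum_mul_sum,
    ← Finset.sum_product', Finset.univ_product_univ, ← Equiv.sum_comp (Fin.appendEquiv n n')]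
  refine Finset.sum_congr rfl fun x _ => ?_
  obtain ⟨x₁, x₂⟩ := x
  rw [← sgn_add]
  have hl : cl₁.length = (P.eval x₁).length := by rw [length_eval, h]
  rw [← dotL_append hl]
  congr 2
  simp [eval_prod]

/-- Reindexing `univ.val.map` along an equivalence. [folklore] -/
theorem univ_val_map_equiv {α β γ : Type*} [Fintype α] [Fintype β] (e : α ≃ β) (F : β → γ) :
    (Finset.univ : Finset β).val.map F = (Finset.univ : Finset α).val.map (F ∘ e) := by
  have h : (Finset.univ : Finset α).val.map e = (Finset.univ : Finset β).val := by
    have h' := congrArg Finset.val (Finset.map_univ_equiv e)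
    rwa [Finset.map_val, Equiv.coe_toEmbedding] at h'
  rw [← Multiset.map_map, h]

/-- Interchanging `Multiset.map` with the multiset product. [folklore] -/
theorem map_mul_product_map {α β : Type*} (s : Multiset α) (t : Multiset β) (f : α → ℤ) (g : β → ℤ) :
    ((s.map f) ×ˢ (t.map g)).map (fun p => p.1 * p.2) = (s ×ˢ t).map (fun p => f p.1 * g p.2) := by
  induction s using Multiset.induction_on with
  | empty => simp
  | cons a s ih =>
    rw [Multiset.map_cons, Multiset.cons_product, Multiset.cons_product, Multiset.map_add,
      Multiset.map_add, ih, Multiset.map_map, Multiset.map_map, Multiset.map_map]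
    rfl

/-- **The census of a direct product is the product of the censuses.**
[DvirGutfreundRothblumVadhan2010, §3 p. 6 and Claim 5.6; LidlNiederreiter1997, Ch. 5] -/
theorem census_prod (P : PolyMapF2 n) (Q : PolyMapF2 n') :
    census (P.prod Q) = mulCensus (census P) (census Q) := by
  rw [census_eq_census', length_prod, census_eq_census', census_eq_census']
  unfold census' mulCensus
  rw [univ_val_map_equiv (Fin.appendEquiv P.length Q.length), map_mul_product_map,
    ← Finset.product_val, Finset.univ_product_univ]
  refine Multiset.map_congr rfl fun cc _ => ?_
  obtain ⟨c₁, c₂⟩ := cc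
  show intBias (outputs (P.prod Q)) (List.ofFn (Fin.append c₁ c₂)) =
    intBias (outputs P) (List.ofFn c₁) * intBias (outputs Q) (List.ofFn c₂)
  rw [List.ofFn_fin_append]
  exact intBias_prod P Q (by simp)

/-- **Census-equivalence is preserved by direct products.** [DvirGutfreundRothblumVadhan2010, §3 p. 6] -/
theorem census_prod_congr {P P' : PolyMapF2 n} {Q Q' : PolyMapF2 n'} (hP : census P = census P')
    (hQ : census Q = census Q') : census (P.prod Q) = census (P'.prod Q') := by
  rw [census_prod, census_prod, hP, hQ]

/-! ### Direct powers and unbounded gaps -/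

/-- The `t`-fold direct power `P × ⋯ × P` on `n·t` variables (print's `pᵗ`).
[DvirGutfreundRothblumVadhan2010, §3 p. 6] -/
def pow (P : PolyMapF2 n) : (t : ℕ) → PolyMapF2 (n * t)
  | 0 => []
  | t + 1 => (pow P t).prod P

/-- Direct powers preserve the degree bound. [DvirGutfreundRothblumVadhan2010, §3 p. 6] -/
theorem pow_degLE {d : ℕ} {P : PolyMapF2 n} (h : P.DegLE d) : ∀ t, (pow P t).DegLE d
  | 0 => degLE_nil d
  | t + 1 => (pow_degLE h t).prod h

/-- `H(Pᵗ) = t · H(P)`. [DvirGutfreundRothblumVadhan2010, §3 p. 6] -/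
theorem entropy_pow (P : PolyMapF2 n) : ∀ t : ℕ, (pow P t).entropy = t * P.entropy
  | 0 => by simp [pow, entropy_nil]
  | t + 1 => by
    rw [pow, entropy_prod, entropy_pow P t]
    push_cast
    ring

/-- Direct powers of census-equivalent maps are census-equivalent. [folklore] -/
theorem census_pow_congr {P P' : PolyMapF2 n} (h : census P = census P') :
    ∀ t : ℕ, census (pow P t) = census (pow P' t)
  | 0 => rfl
  | t + 1 => census_prod_congr (census_pow_congr h t) h

/-- **Amplification**: a census-equivalent pair with entropy gap `> δ` gives, for every `t`, a
census-equivalent pair (its `t`-th powers) with gap `≥ t·δ`. [DvirGutfreundRothblumVadhan2010, §3 p. 6] -/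
theorem census_gap_amplify {P P' : PolyMapF2 n} (hc : census P = census P') {δ : ℝ}
    (hgap : δ < P'.entropy - P.entropy) (t : ℕ) :
    census (pow P t) = census (pow P' t) ∧ (t : ℝ) * δ ≤ (pow P' t).entropy - (pow P t).entropy := by
  refine ⟨census_pow_congr hc t, ?_⟩
  rw [entropy_pow, entropy_pow, ← mul_sub]
  exact mul_le_mul_of_nonneg_left hgap.le (Nat.cast_nonneg t)

/-- **Census-equivalent quadratic maps have unbounded Shannon-entropy gaps**: for every `T` there are
quadratic maps `C, D` (powers of `witA`, `witB`, on `4·(3T+3)` variables) with identical signed bias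
census and `H(D) − H(C) > T`.  Hence no function of the rank/type/bias census of the pencil
approximates the entropy of quadratic maps over `F₂` to within any additive constant.
[DvirGutfreundRothblumVadhan2010, Claim 5.6 (the census fixes only the Rényi entropy)] -/
theorem census_equivalent_gap_unbounded (T : ℕ) :
    ∃ N : ℕ, ∃ C D : PolyMapF2 N, C.DegLE 2 ∧ D.DegLE 2 ∧ census C = census D ∧
      (T : ℝ) < D.entropy - C.entropy := by
  obtain ⟨hc, hgap⟩ := census_gap_amplify census_witA_eq_witB entropy_gap_AB (3 * T + 3)
  refine ⟨4 * (3 * T + 3), pow witA (3 * T + 3), pow witB (3 * T + 3), pow_degLE witA_degLE _,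
    pow_degLE witB_degLE _, hc, lt_of_lt_of_le ?_ hgap⟩
  push_cast
  nlinarith

end Summit.PneNP.PneNP.Theorems.PeaTwoMemBPP.Negative
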